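import Mathlib
import Literature.NumberTheory.Transcendental.KZProduct
import Literature.NumberTheory.Transcendental.KZProductIdeal
import Literature.NumberTheory.Transcendental.KZSubcalculusInvariants
import Literature.NumberTheory.Transcendental.BoxIntegralZetaValues
import Summits.KontsevichZagierPeriods.KontsevichZagierPeriods.Theorems.SoloInformedPolyJacobian
import Summits.KontsevichZagierPeriods.KontsevichZagierPeriods.Theorems.SoloInformedPiDiscQuarters
import Summits.KontsevichZagierPeriods.KontsevichZagierPeriods.Theorems.SoloInformedHalfAngle
import HarnessLib
import HarnessLib.Audit

/-!
# SoloInformed — `ζ(2) = π²/6` in the KZ calculus, I: the representations and the first moves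

The integral representations of the chain proving Euler's identity inside the Kontsevich–Zagier
four-move calculus (`SoloInformedZetaTwo`):

* `Z = [(0,1)², 1/(1 − xy)]` — Beukers' integral, `value Z = ζ(2) = π²/6` (integrability and value
  from the tree's `BoxIntegralZetaValues`); `J = [(0,1)², 1/(1 − x²y²)]`, `W = [(0,1)², xy/(1 − x²y²)]`,
  `Z₄ = [(0,1)², ¼/(1 − xy)]`;
* `P₄ = 4 · ([0,1], 1/(1+a²)) ⊗ ([0,1], 1/(1+b²))` and its restrictions to the open square, to
  the Calabi triangle `T` and to the co-triangle `T'`;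

and the first three moves: `[Z] − [J] − [W]` (rule 1b, `1/(1−t) = 1/(1−t²) + t/(1−t²)`),
`[W] − [Z₄]` (rule 2, the squaring map `(x,y) ↦ (x²,y²)`, Jacobian `4xy`), hence
`3·[Z] − 4·[J] ∈ KZ.relations` (the calculus form of `ζ(2) − ¼ζ(2) = Σ_{k odd} 1/k²`).
[Kontsevich–Zagier 2001, §1.2; Beukers–Calabi–Kolk 1993]

Residency `solo-KontsevichZagierPeriods-informed` (PLAN.md, session s17).
-/

noncomputable section

namespace Summit.KontsevichZagierPeriods.KontsevichZagierPeriods.Theorems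

open Literature.NumberTheory.Transcendental Literature.NumberTheory.Transcendental.KZ MvPolynomial Set
  MeasureTheory

/-! ### The representations -/

/-- On the open square `0 < 1 − xy`. -/
theorem soloInformed_one_sub_mul_pos {z : Fin 2 → ℝ} (hz : z ∈ soloInformedOpenSq) :
    0 < 1 - z 0 * z 1 := by
  rw [soloInformed_mem_openSq] at hz
  nlinarith [mul_pos hz.1.1 hz.2.1]

/-- On the open square `0 < 1 − (xy)²`. -/
theorem soloInformed_one_sub_mul_sq_pos {z : Fin 2 → ℝ} (hz : z ∈ soloInformedOpenSq) :
    0 < 1 - (z 0 * z 1) ^ 2 := by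
  have h := soloInformed_one_sub_mul_pos hz
  rw [soloInformed_mem_openSq] at hz
  have : z 0 * z 1 < 1 := by linarith
  nlinarith [mul_pos hz.1.1 hz.2.1]

/-- The open square is measurable. -/
theorem soloInformed_measurableSet_openSq : MeasurableSet soloInformedOpenSq := by
  have : soloInformedOpenSq = ({u : Fin 2 → ℝ | 0 < u 0} ∩ {u | u 0 < 1}) ∩
      ({u | 0 < u 1} ∩ {u | u 1 < 1}) := by
    ext u; simp [soloInformed_mem_openSq]
  rw [this]
  refine ((measurableSet_lt measurable_const (measurable_pi_apply 0)).inter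
    (measurableSet_lt (measurable_pi_apply 0) measurable_const)).inter
    ((measurableSet_lt measurable_const (measurable_pi_apply 1)).inter
    (measurableSet_lt (measurable_pi_apply 1) measurable_const))

/-- **`Z = [(0,1)², 1/(1 − xy)]`**, Beukers' double integral for `ζ(2)`; integrable by
`BoxIntegralZetaValues`. [Kontsevich–Zagier 2001, §1.1; Beukers 1979] -/
def soloInformedZetaTwoRep : IntegralRep 2 where
  domain := soloInformedOpenSq
  integrand z := 1 / (1 - z 0 * z 1)
  isSemialgebraic_domain := isSemialgebraic_soloInformedOpenSq
  isSemialgebraicFunOn_integrand := by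
    refine (isSemialgebraicFunOn_aeval_div_aeval isSemialgebraic_soloInformedOpenSq 1
      (1 - X 0 * X 1 : MvPolynomial (Fin 2) ℚ) fun z hz => ?_).congr fun z _ => by simp
    simpa using (soloInformed_one_sub_mul_pos hz).ne'
  integrableOn := box_integral_one_div_one_sub_mul_two.1

/-- Domain of `Z`. -/
@[simp] theorem soloInformedZetaTwoRep_domain : soloInformedZetaTwoRep.domain = soloInformedOpenSq := rfl
/-- Integrand of `Z`. -/
@[simp] theorem soloInformedZetaTwoRep_integrand :
    soloInformedZetaTwoRep.integrand = fun z => 1 / (1 - z 0 * z 1) := rfl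

/-- `Z` has the literal shape of the Definition. -/
theorem soloInformed_zetaTwoRep_isRational : soloInformedZetaTwoRep.IsRational := by
  refine ⟨1, 1 - X 0 * X 1, fun z hz => ?_, fun z _ => by simp⟩
  simpa using (soloInformed_one_sub_mul_pos hz).ne'

/-- **`value Z = π²/6`** (Euler; here from the tree's `BoxIntegralZetaValues`). -/
theorem soloInformed_zetaTwoRep_value : soloInformedZetaTwoRep.value = Real.pi ^ 2 / 6 :=
  box_integral_one_div_one_sub_mul_two.2

/-- A continuous function dominated by a multiple of `1/(1 − xy)` on the open square is integrable
there. -/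
theorem soloInformed_integrableOn_openSq_of_le (f : (Fin 2 → ℝ) → ℝ)
    (hf : ContinuousOn f soloInformedOpenSq) (C : ℝ)
    (hle : ∀ z ∈ soloInformedOpenSq, |f z| ≤ C * (1 / (1 - z 0 * z 1))) :
    IntegrableOn f soloInformedOpenSq := by
  have hZ : IntegrableOn (fun z : Fin 2 → ℝ => C * (1 / (1 - z 0 * z 1))) soloInformedOpenSq :=
    (box_integral_one_div_one_sub_mul_two.1).const_mul C
  refine Integrable.mono' hZ (hf.aestronglyMeasurable soloInformed_measurableSet_openSq) ?_
  exact (ae_restrict_iff' soloInformed_measurableSet_openSq).2 (ae_of_all _ fun z hz => by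
    simpa [Real.norm_eq_abs] using hle z hz)

/-- **`J = [(0,1)², 1/(1 − x²y²)]`** (`= Σ 1/(2k+1)² = π²/8`). -/
def soloInformedJRep : IntegralRep 2 where
  domain := soloInformedOpenSq
  integrand z := 1 / (1 - (z 0 * z 1) ^ 2)
  isSemialgebraic_domain := isSemialgebraic_soloInformedOpenSq
  isSemialgebraicFunOn_integrand := by
    refine (isSemialgebraicFunOn_aeval_div_aeval isSemialgebraic_soloInformedOpenSq 1
      (1 - (X 0 * X 1) ^ 2 : MvPolynomial (Fin 2) ℚ) fun z hz => ?_).congr fun z _ => by simp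
    simpa using (soloInformed_one_sub_mul_sq_pos hz).ne'
  integrableOn := by
    refine soloInformed_integrableOn_openSq_of_le _ (ContinuousOn.div continuousOn_const
      (by fun_prop) fun z hz => (soloInformed_one_sub_mul_sq_pos hz).ne') 1 fun z hz => ?_
    have h1 := soloInformed_one_sub_mul_pos hz
    have h2 := soloInformed_one_sub_mul_sq_pos hz
    rw [soloInformed_mem_openSq] at hz
    rw [abs_of_pos (by positivity), one_mul, div_le_div_iff₀ h2 h1, one_mul, one_mul]
    nlinarith [mul_pos hz.1.1 hz.2.1]

/-- Domain of `J`. -/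
@[simp] theorem soloInformedJRep_domain : soloInformedJRep.domain = soloInformedOpenSq := rfl
/-- Integrand of `J`. -/
@[simp] theorem soloInformedJRep_integrand :
    soloInformedJRep.integrand = fun z => 1 / (1 - (z 0 * z 1) ^ 2) := rfl

/-- **`W = [(0,1)², xy/(1 − x²y²)]`.** -/
def soloInformedWRep : IntegralRep 2 where
  domain := soloInformedOpenSq
  integrand z := z 0 * z 1 / (1 - (z 0 * z 1) ^ 2)
  isSemialgebraic_domain := isSemialgebraic_soloInformedOpenSq
  isSemialgebraicFunOn_integrand := by
    refine (isSemialgebraicFunOn_aeval_div_aeval isSemialgebraic_soloInformedOpenSq (X 0 * X 1)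
      (1 - (X 0 * X 1) ^ 2 : MvPolynomial (Fin 2) ℚ) fun z hz => ?_).congr fun z _ => by simp
    simpa using (soloInformed_one_sub_mul_sq_pos hz).ne'
  integrableOn := by
    refine soloInformed_integrableOn_openSq_of_le _ (ContinuousOn.div (by fun_prop)
      (by fun_prop) fun z hz => (soloInformed_one_sub_mul_sq_pos hz).ne') 1 fun z hz => ?_
    have h1 := soloInformed_one_sub_mul_pos hz
    have h2 := soloInformed_one_sub_mul_sq_pos hz
    rw [soloInformed_mem_openSq] at hz
    have h12 := mul_pos hz.1.1 hz.2.1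
    rw [abs_of_pos (by positivity), one_mul, div_le_div_iff₀ h2 h1, one_mul]
    nlinarith [mul_pos hz.1.1 hz.2.1]

/-- Domain of `W`. -/
@[simp] theorem soloInformedWRep_domain : soloInformedWRep.domain = soloInformedOpenSq := rfl
/-- Integrand of `W`. -/
@[simp] theorem soloInformedWRep_integrand :
    soloInformedWRep.integrand = fun z => z 0 * z 1 / (1 - (z 0 * z 1) ^ 2) := rfl

/-- **`Z₄ = [(0,1)², ¼ · 1/(1 − xy)]`.** -/
def soloInformedZ4Rep : IntegralRep 2 where
  domain := soloInformedOpenSq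
  integrand z := (4 : ℝ)⁻¹ * (1 / (1 - z 0 * z 1))
  isSemialgebraic_domain := isSemialgebraic_soloInformedOpenSq
  isSemialgebraicFunOn_integrand := by
    refine (isSemialgebraicFunOn_aeval_div_aeval isSemialgebraic_soloInformedOpenSq (C 4⁻¹)
      (1 - X 0 * X 1 : MvPolynomial (Fin 2) ℚ) fun z hz => ?_).congr fun z _ => by
        simp [div_eq_mul_one_div (4 : ℝ)⁻¹]
    simpa using (soloInformed_one_sub_mul_pos hz).ne'
  integrableOn := (box_integral_one_div_one_sub_mul_two.1).const_mul _

/-- Domain of `Z₄`. -/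
@[simp] theorem soloInformedZ4Rep_domain : soloInformedZ4Rep.domain = soloInformedOpenSq := rfl
/-- Integrand of `Z₄`. -/
@[simp] theorem soloInformedZ4Rep_integrand :
    soloInformedZ4Rep.integrand = fun z => (4 : ℝ)⁻¹ * (1 / (1 - z 0 * z 1)) := rfl

/-- `Z = 4 · Z₄` as representations (same domain, same integrand function). -/
theorem soloInformed_zetaTwoRep_eq_constMul :
    soloInformedZetaTwoRep = soloInformedZ4Rep.constMul ((4 : ℕ) : ℝ) (isAlgebraic_nat 4) := by
  refine IntegralRep.ext' rfl (funext fun z => ?_)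
  simp

/-! ### The product square `4 · ([0,1], 1/(1+a²)) ⊗ ([0,1], 1/(1+b²))` and its pieces -/

/-- The first coordinate of a point of `ℝ¹⁺¹`, as used by `IntegralRep.prodDomain`. -/
theorem soloInformed_castAdd_one_eq (z : Fin 2 → ℝ) :
    (fun i : Fin 1 => z (Fin.castAdd 1 i)) = ![z 0] := by
  ext i; fin_cases i; rfl

/-- The second coordinate of a point of `ℝ¹⁺¹`, as used by `IntegralRep.prodDomain`. -/
theorem soloInformed_natAdd_one_eq' (z : Fin 2 → ℝ) :
    (fun j : Fin 1 => z (Fin.natAdd 1 j)) = ![z 1] := by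
  ext j; fin_cases j; rfl

/-- **`P₄ = 4 · [[0,1]², 1/((1+a²)(1+b²))]`** (`4 ·` the product of two arctangent
representations). -/
def soloInformedP4Rep : IntegralRep 2 :=
  (soloInformedArctanRep.prod soloInformedArctanRep).constMul ((4 : ℕ) : ℝ) (isAlgebraic_nat 4)

/-- Membership in the domain `[0,1]²` of `P₄`. -/
theorem soloInformed_mem_P4Rep_domain {z : Fin 2 → ℝ} :
    z ∈ soloInformedP4Rep.domain ↔ (0 ≤ z 0 ∧ z 0 ≤ 1) ∧ (0 ≤ z 1 ∧ z 1 ≤ 1) := by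
  rw [soloInformedP4Rep, IntegralRep.domain_constMul, IntegralRep.prod_domain,
    IntegralRep.mem_prodDomain, soloInformed_castAdd_one_eq, soloInformed_natAdd_one_eq']
  simp [soloInformedUnitI]

/-- The integrand of `P₄` is `4/((1+a²)(1+b²))`. -/
theorem soloInformed_P4Rep_integrand (z : Fin 2 → ℝ) :
    soloInformedP4Rep.integrand z = 4 * (1 / (1 + z 0 ^ 2) * (1 / (1 + z 1 ^ 2))) := by
  simp only [soloInformedP4Rep, IntegralRep.integrand_constMul, IntegralRep.prod_integrand_eq,
    IntegralRep.prodFun_apply, soloInformed_castAdd_one_eq, soloInformed_natAdd_one_eq']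
  simp

/-- The open square lies in `[0,1]²`. -/
theorem soloInformedOpenSq_subset_P4 : soloInformedOpenSq ⊆ soloInformedP4Rep.domain := fun z hz => by
  rw [soloInformed_mem_openSq] at hz
  exact soloInformed_mem_P4Rep_domain.2 ⟨⟨hz.1.1.le, hz.1.2.le⟩, hz.2.1.le, hz.2.2.le⟩

/-- `[(0,1)², 4/((1+a²)(1+b²))]`. -/
def soloInformedSq4Rep : IntegralRep 2 :=
  soloInformedP4Rep.restrict soloInformedOpenSq isSemialgebraic_soloInformedOpenSq
    soloInformedOpenSq_subset_P4

/-- `[T ∪ T', 4/((1+a²)(1+b²))]`. -/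
def soloInformedSq4Rep' : IntegralRep 2 :=
  soloInformedP4Rep.restrict (soloInformedCalabiSrc ∪ soloInformedCalabiCo)
    (isSemialgebraic_soloInformedCalabiSrc.union isSemialgebraic_soloInformedCalabiCo)
    (union_subset (soloInformedCalabiSrc_subset_openSq.trans soloInformedOpenSq_subset_P4)
      (soloInformedCalabiCo_subset_openSq.trans soloInformedOpenSq_subset_P4))

/-- **`[T, 4/((1+a²)(1+b²))]`**, the Calabi triangle piece. -/
def soloInformedCalabiTriRep : IntegralRep 2 :=
  soloInformedP4Rep.restrict soloInformedCalabiSrc isSemialgebraic_soloInformedCalabiSrc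
    (soloInformedCalabiSrc_subset_openSq.trans soloInformedOpenSq_subset_P4)

/-- `[T', 4/((1+a²)(1+b²))]`, the co-triangle piece. -/
def soloInformedCalabiCoRep : IntegralRep 2 :=
  soloInformedP4Rep.restrict soloInformedCalabiCo isSemialgebraic_soloInformedCalabiCo
    (soloInformedCalabiCo_subset_openSq.trans soloInformedOpenSq_subset_P4)

/-! ### The moves -/

/-- **Step 1** (rule 1b): `[Z] − [J] − [W] ∈ relations` (`1/(1−t) = 1/(1−t²) + t/(1−t²)`). -/
theorem soloInformed_zeta_sub_J_sub_W_mem_relations :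
    of soloInformedZetaTwoRep - of soloInformedJRep - of soloInformedWRep ∈ relations := by
  refine integrandAddRel_subset_relations ⟨2, soloInformedZetaTwoRep, soloInformedJRep,
    soloInformedWRep, rfl, rfl, fun z hz => ?_, rfl⟩
  have h1 := soloInformed_one_sub_mul_pos hz
  have h2 := soloInformed_one_sub_mul_sq_pos hz
  have h2' : (1 : ℝ) - z 0 ^ 2 * z 1 ^ 2 ≠ 0 := by rw [← mul_pow]; exact h2.ne'
  simp only [soloInformedZetaTwoRep_integrand, soloInformedJRep_integrand,
    soloInformedWRep_integrand, Pi.add_apply]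
  field_simp
  ring

/-- The squaring map `(x, y) ↦ (x², y²)`. -/
def soloInformedSqPoly : Fin 2 → MvPolynomial (Fin 2) ℚ := ![X 0 ^ 2, X 1 ^ 2]

/-- First component of the squaring map. -/
@[simp] theorem soloInformed_sqMap_apply_zero (u : Fin 2 → ℝ) :
    soloInformedPolyMap soloInformedSqPoly u 0 = u 0 ^ 2 := by
  simp [soloInformedPolyMap, soloInformedSqPoly]

/-- Second component of the squaring map. -/
@[simp] theorem soloInformed_sqMap_apply_one (u : Fin 2 → ℝ) :
    soloInformedPolyMap soloInformedSqPoly u 1 = u 1 ^ 2 := by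
  simp [soloInformedPolyMap, soloInformedSqPoly]

/-- `det` of the Jacobian of the squaring map is `4xy`. -/
theorem soloInformed_det_sqMap (u : Fin 2 → ℝ) :
    (soloInformedJacCLM soloInformedSqPoly u).det = 4 * (u 0 * u 1) := by
  rw [soloInformed_det_jacCLM, Matrix.det_fin_two]
  simp [soloInformedJacMat_apply, soloInformedSqPoly, pderiv_X]
  ring

/-- The squaring map sends the open square onto itself. -/
theorem soloInformed_sqMap_image :
    soloInformedPolyMap soloInformedSqPoly '' soloInformedOpenSq = soloInformedOpenSq := by
  refine Set.Subset.antisymm ?_ fun x hx => ?_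
  · rintro _ ⟨u, hu, rfl⟩
    rw [soloInformed_mem_openSq] at hu ⊢
    simp only [soloInformed_sqMap_apply_zero, soloInformed_sqMap_apply_one]
    obtain ⟨⟨h0, h0'⟩, h1, h1'⟩ := hu
    exact ⟨⟨by positivity, by nlinarith⟩, by positivity, by nlinarith⟩
  · rw [soloInformed_mem_openSq] at hx
    obtain ⟨⟨h0, h0'⟩, h1, h1'⟩ := hx
    refine ⟨![Real.sqrt (x 0), Real.sqrt (x 1)], ?_, ?_⟩
    · rw [soloInformed_mem_openSq]
      simp only [Matrix.cons_val_zero, Matrix.cons_val_one]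
      exact ⟨⟨Real.sqrt_pos.2 h0, (Real.sqrt_lt' one_pos).2 (by rw [one_pow]; exact h0')⟩,
        Real.sqrt_pos.2 h1, (Real.sqrt_lt' one_pos).2 (by rw [one_pow]; exact h1')⟩
    · funext i; fin_cases i
      · simp [soloInformedSqPoly, Real.sq_sqrt h0.le]
      · simp [soloInformedSqPoly, Real.sq_sqrt h1.le]

/-- **Step 2** (rule 2, squaring map): `[W] − [Z₄] ∈ relations`. -/
theorem soloInformed_W_sub_Z4_mem_relations :
    of soloInformedWRep - of soloInformedZ4Rep ∈ relations := by
  refine changeOfVariablesRel_subset_relations ⟨2, soloInformedWRep, soloInformedZ4Rep,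
    soloInformedPolyMap soloInformedSqPoly, soloInformedJacCLM soloInformedSqPoly,
    isSemialgebraicMapOn_aeval isSemialgebraic_soloInformedOpenSq soloInformedSqPoly,
    fun u _ => (soloInformed_hasFDerivAt_polyMap soloInformedSqPoly u).hasFDerivWithinAt,
    ?_, soloInformed_sqMap_image.symm, fun u hu => ?_, rfl⟩
  · intro u hu v hv huv
    rw [soloInformedWRep_domain, soloInformed_mem_openSq] at hu hv
    have e0 : u 0 ^ 2 = v 0 ^ 2 := by
      simpa only [soloInformed_sqMap_apply_zero] using congr_fun huv 0
    have e1 : u 1 ^ 2 = v 1 ^ 2 := by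
      simpa only [soloInformed_sqMap_apply_one] using congr_fun huv 1
    have h0 := (sq_eq_sq₀ hu.1.1.le hv.1.1.le).1 e0
    have h1 := (sq_eq_sq₀ hu.2.1.le hv.2.1.le).1 e1
    funext i; fin_cases i
    · exact h0
    · exact h1
  · have hpos := soloInformed_one_sub_mul_sq_pos hu
    rw [soloInformedWRep_domain, soloInformed_mem_openSq] at hu
    have h12 := mul_pos hu.1.1 hu.2.1
    rw [soloInformed_det_sqMap, abs_of_pos (by positivity)]
    simp only [soloInformedWRep_integrand, soloInformedZ4Rep_integrand, soloInformed_sqMap_apply_zero,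
      soloInformed_sqMap_apply_one]
    have : (1 : ℝ) - u 0 ^ 2 * u 1 ^ 2 ≠ 0 := by rw [← mul_pow]; exact hpos.ne'
    field_simp

/-- **Steps 1–3 combined**: `3·[Z] − 4·[J] ∈ relations`. -/
theorem soloInformed_three_zeta_sub_four_J_mem_relations :
    3 • of soloInformedZetaTwoRep - 4 • of soloInformedJRep ∈ relations := by
  have R1 := soloInformed_zeta_sub_J_sub_W_mem_relations
  have R2 := soloInformed_W_sub_Z4_mem_relations
  have R3 : of soloInformedZetaTwoRep - 4 • of soloInformedZ4Rep ∈ relations := by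
    rw [soloInformed_zetaTwoRep_eq_constMul]
    exact IntegralRep.of_constMul_nat_sub_nsmul_mem_relations soloInformedZ4Rep 4
  have e : 3 • of soloInformedZetaTwoRep - 4 • of soloInformedJRep =
      4 • (of soloInformedZetaTwoRep - of soloInformedJRep - of soloInformedWRep) +
        4 • (of soloInformedWRep - of soloInformedZ4Rep) -
        (of soloInformedZetaTwoRep - 4 • of soloInformedZ4Rep) := by
    abel
  rw [e]
  exact relations.sub_mem (relations.add_mem (relations.nsmul_mem R1 4) (relations.nsmul_mem R2 4)) R3

end Summit.KontsevichZagierPeriods.KontsevichZagierPeriods.Theorems
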